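import Summits.NavierStokesRegularity.NavierStokesRegularity.Theorems.StableStrataDoorWindowLimit

/-!
# StableStrataDoorAxiStability — S26 «StableStrataDoor» (ε-STABLE STRATA: the open-neighbourhood principle K-stab(Φ,𝔖) and the
ε-AXISYMMETRIC Type-I door, uniform in the axis), part 3/6: Fatou, analytic spread, K-axi and door T-axi PROVED (§5–§7)

§5 the limit: zero defect on the window (Fatou, `axiDefect_limit_eq_zero`) and exact axisymmetry of an analytic slice
(identity theorem, `isAxisymmetric_conj_of_window`); §6 **K-axi PROVED** `axiStability_holds : AxiStability` — ε-STABILITY OF THE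
AXISYMMETRIC TYPE-I LIOUVILLE THEOREM (bad sequence ⇒ B0 normalisation `normalise` ⇒ E1 `extraction` ⇒ E2 `classical_limit` ⇒
E3 `analytic_slices_of_decay` (tree, S25) ⇒ §5 ⇒ time shift ⇒ KNSS 2009 Thm 5.3 (tree
`IsAncientMildSolution.ae_eq_zero_of_isAxisymmetric_conj_of_hasTypeIDecay`) ⇒ the normalised witness is contradicted);
§7 the UNCONDITIONAL door T-axi `targetEpsAxisym_holds : TargetEpsAxisym` «no ε-axisymmetric Type-I blow-up».

Door family of LADDER-NS N0 (local Type-I window doors S20–S26); THEOREMS-ONLY landing of the nsreg-p1 design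
`run/shared/lean/pub/ns-regularity-ideate/ns-regularity-ideate-p1/r25/Sketch26.lean` (ROUND-25.md; sha16 bf87a99673b3e6ef,
farm rc 0 / 0 sorry), split by section into `StableStrataDoor{Defs, WindowLimit, AxiStability, Schema, Instances, Uniform}`,
texts verbatim, namespace = file stem.  No route, no items (DIRECTOR-NS standing #32 (2); landing lane ns-door-S23-p1).
WHAT THIS IS NOT: not NS regularity (Clay (A)) and not a dent in `NoTypeII` (stmt-0056) — every statement lives INSIDE the
Type-I class; not the swirl hard cores (no Type-I-free statement); not the Type-I Liouville conjecture — only window-open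
neighbourhoods of strata where it is already a theorem; `ε` comes from compactness and is NOT explicit.
-/

noncomputable section

set_option linter.dupNamespace false

namespace Summit.NavierStokesRegularity.NavierStokesRegularity.Theorems.StableStrataDoorAxiStability

open MeasureTheory Set Function Filter Topology TopologicalSpace Metric
open scoped RealInnerProductSpace NNReal ENNReal Topology Pointwise
open Literature.Analysis Literature.Analysis.FluidPDE
open Summit.NavierStokesRegularity.NavierStokesRegularity.Theorems.PoloidalWindowDoorPoloidalWindowRigidityWindow
open Summit.NavierStokesRegularity.NavierStokesRegularity.Theorems.ZoomReturnDoorDefs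
open Summit.NavierStokesRegularity.NavierStokesRegularity.Theorems.ZoomReturnDoorWindowLimit
open Summit.NavierStokesRegularity.NavierStokesRegularity.Theorems.ZoomReturnDoorRemovableFactors
open Summit.NavierStokesRegularity.NavierStokesRegularity.Theorems.ZoomReturnDoorGlue
open Summit.NavierStokesRegularity.NavierStokesRegularity.Theorems.ZoomReturnDoorExtraction
open Summit.NavierStokesRegularity.NavierStokesRegularity.Theorems.ZoomReturnDoorClassicalLimit
open Summit.NavierStokesRegularity.NavierStokesRegularity.Theorems.StableStrataDoorDefs
open Summit.NavierStokesRegularity.NavierStokesRegularity.Theorems.StableStrataDoorWindowLimit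

/-! ## §5 The limit: zero defect on the window (Fatou), exact axisymmetry of the slice (analytic spread) -/

section Limit

variable {ν : ℝ} {vn : ℕ → ℝ → EuclideanSpace ℝ (Fin 3) → EuclideanSpace ℝ (Fin 3)}
  {v : ℝ → EuclideanSpace ℝ (Fin 3) → EuclideanSpace ℝ (Fin 3)} {εn : ℕ → ℝ} {t₁ : ℝ}

/-- **Fatou.** Pointwise convergence of slices below `t₁ ≤ 0`, continuous slices, defects `≤ εₙ → 0` on an open `U` ⇒ the
limit has ZERO defect at every window point, every angle, every profile time `s < t₁`. -/
theorem axiDefect_limit_eq_zero (ht₁ : t₁ ≤ 0) (hεn : Tendsto εn atTop (𝓝 0))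
    (hslice : ∀ n, ∀ t < 0, Continuous (vn n t)) (hvslice : ∀ t < t₁, Continuous (v t))
    (hpt : ∀ t < t₁, ∀ y, Tendsto (fun n => vn n t y) atTop (𝓝 (v t y)))
    (A : EuclideanSpace ℝ (Fin 3) ≃ₗᵢ[ℝ] EuclideanSpace ℝ (Fin 3)) {U : Set (EuclideanSpace ℝ (Fin 3))} (hU : IsOpen U)
    (hsmall : ∀ n, HasSmallAxiDefectOn ν A (εn n) U (vn n)) :
    ∀ s < t₁, ∀ θ, ∀ ζ ∈ U, axiDefect A (profileWindowField ν v s) θ ζ = 0 := by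
  intro s hs₁ θ
  have hs : s < 0 := lt_of_lt_of_le hs₁ ht₁
  set F : ℕ → EuclideanSpace ℝ (Fin 3) → ℝ≥0∞ := fun n ζ => ENNReal.ofReal (axiDefect A (profileWindowField ν (vn n) s) θ ζ)
    with hF
  have hFc : ∀ n, Continuous fun ζ => axiDefect A (profileWindowField ν (vn n) s) θ ζ :=
    fun n => continuous_axiDefect A (continuous_profileWindowField (hslice n s hs)) θ
  have hFm : ∀ n, Measurable (F n) := fun n => (ENNReal.continuous_ofReal.comp (hFc n)).measurable
  have hconvW : ∀ y, Tendsto (fun n => profileWindowField ν (vn n) s y) atTop (𝓝 (profileWindowField ν v s y)) :=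
    fun y => (hpt s hs₁ _).const_smul _
  have hptw : ∀ ζ, Tendsto (fun n => F n ζ) atTop (𝓝 (ENNReal.ofReal (axiDefect A (profileWindowField ν v s) θ ζ))) :=
    fun ζ => ENNReal.tendsto_ofReal (tendsto_axiDefect A θ ζ (hconvW (A ζ)) (hconvW (A (rotZ θ ζ))))
  have hFatou : ∫⁻ ζ in U, liminf (fun n => F n ζ) atTop ≤ liminf (fun n => ∫⁻ ζ in U, F n ζ) atTop :=
    lintegral_liminf_le' fun n => (hFm n).aemeasurable
  have hlim : (fun ζ => liminf (fun n => F n ζ) atTop) =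
      fun ζ => ENNReal.ofReal (axiDefect A (profileWindowField ν v s) θ ζ) :=
    funext fun ζ => (hptw ζ).liminf_eq
  rw [hlim] at hFatou
  have hbound : ∀ n, ∫⁻ ζ in U, F n ζ ≤ ENNReal.ofReal (εn n) := fun n => hsmall n s hs θ
  have hlimle : liminf (fun n => ∫⁻ ζ in U, F n ζ) atTop ≤ liminf (fun n => ENNReal.ofReal (εn n)) atTop :=
    liminf_le_liminf (Eventually.of_forall hbound)
  have hε0 : liminf (fun n => ENNReal.ofReal (εn n)) atTop = 0 := by
    rw [(ENNReal.tendsto_ofReal hεn).liminf_eq, ENNReal.ofReal_zero]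
  have hint : ∫⁻ ζ in U, ENNReal.ofReal (axiDefect A (profileWindowField ν v s) θ ζ) = 0 :=
    le_antisymm ((hFatou.trans hlimle).trans hε0.le) bot_le
  -- continuity ⇒ pointwise zero on the open window
  have hgc : Continuous fun ζ => axiDefect A (profileWindowField ν v s) θ ζ :=
    continuous_axiDefect A (continuous_profileWindowField (hvslice s hs₁)) θ
  have hgm : Measurable fun ζ => ENNReal.ofReal (axiDefect A (profileWindowField ν v s) θ ζ) :=
    (ENNReal.continuous_ofReal.comp hgc).measurable
  have hae : (fun ζ => ENNReal.ofReal (axiDefect A (profileWindowField ν v s) θ ζ)) =ᵐ[volume.restrict U] 0 :=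
    (lintegral_eq_zero_iff hgm).1 hint
  have heq : EqOn (fun ζ => ENNReal.ofReal (axiDefect A (profileWindowField ν v s) θ ζ)) 0 U :=
    Measure.eqOn_open_of_ae_eq hae hU (ENNReal.continuous_ofReal.comp hgc).continuousOn continuousOn_const
  intro ζ hζ
  have h := heq hζ
  simp only [Pi.zero_apply, ENNReal.ofReal_eq_zero] at h
  exact le_antisymm h (norm_nonneg _)

/-- **ANALYTIC SPREAD at a fixed time: zero defect on an open nonempty window + analytic slice ⇒ the slice is EXACTLY
axisymmetric about `A e₃`** (identity theorem on `ℝ³`; the window scale `σ > 0` is undone by the dilation invariance of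
the stratum). -/
theorem isAxisymmetric_conj_of_window (hν : 0 < ν) {s : ℝ} (hs : s < 0) (han : AnalyticOnNhd ℝ (v s) univ)
    (A : EuclideanSpace ℝ (Fin 3) ≃ₗᵢ[ℝ] EuclideanSpace ℝ (Fin 3)) {U : Set (EuclideanSpace ℝ (Fin 3))} (hU : IsOpen U)
    (hUne : U.Nonempty) (hwin : ∀ θ, ∀ ζ ∈ U, axiDefect A (profileWindowField ν v s) θ ζ = 0) :
    IsAxisymmetric (fun x => A.symm (v s (A x))) := by
  intro θ x
  have hns : 0 < -s := neg_pos.2 hs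
  set σ : ℝ := Real.sqrt (-s) / Real.sqrt ν with hσ
  have hσpos : 0 < σ := div_pos (Real.sqrt_pos.2 hns) (Real.sqrt_pos.2 hν)
  have hσν : σ * ν ≠ 0 := mul_ne_zero hσpos.ne' hν.ne'
  -- the three linear maps as continuous linear maps (for analyticity)
  set Acl : EuclideanSpace ℝ (Fin 3) →L[ℝ] EuclideanSpace ℝ (Fin 3) := A.toContinuousLinearEquiv.toContinuousLinearMap
    with hAcl_def
  have hAcl : ∀ z, Acl z = A z := fun z => rfl
  set Ascl : EuclideanSpace ℝ (Fin 3) →L[ℝ] EuclideanSpace ℝ (Fin 3) :=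
    A.symm.toContinuousLinearEquiv.toContinuousLinearMap with hAscl_def
  have hAscl : ∀ z, Ascl z = A.symm z := fun z => rfl
  set Rcl : EuclideanSpace ℝ (Fin 3) →L[ℝ] EuclideanSpace ℝ (Fin 3) :=
    (rotZLIE θ).toContinuousLinearEquiv.toContinuousLinearMap with hRcl_def
  have hRcl : ∀ z, Rcl z = rotZ θ z := fun z => rfl
  -- the defect field `f` is real-analytic on `ℝ³`
  set f : EuclideanSpace ℝ (Fin 3) → EuclideanSpace ℝ (Fin 3) := fun ζ =>
    rotZ θ (A.symm (profileWindowField ν v s (A ζ))) - A.symm (profileWindowField ν v s (A (rotZ θ ζ))) with hf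
  have hPW : AnalyticOnNhd ℝ (profileWindowField ν v s) univ := by
    have hlin : AnalyticOnNhd ℝ (fun w : EuclideanSpace ℝ (Fin 3) => σ • w) univ := fun w _ =>
      analyticAt_id.const_smul (c := σ)
    have h1 : AnalyticOnNhd ℝ (fun w : EuclideanSpace ℝ (Fin 3) => v s (σ • w)) univ :=
      han.comp hlin fun _ _ => mem_univ _
    have h2 : AnalyticOnNhd ℝ (fun w : EuclideanSpace ℝ (Fin 3) => (σ * ν) • v s (σ • w)) univ := fun w hw =>
      (h1 w hw).const_smul (c := σ * ν)
    have hfun : profileWindowField ν v s = fun w => (σ * ν) • v s (σ • w) := by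
      funext w; simp only [profileWindowField, hσ]
    rw [hfun]; exact h2
  have hfan : AnalyticOnNhd ℝ f univ := by
    have a1 : AnalyticOnNhd ℝ (fun ζ : EuclideanSpace ℝ (Fin 3) => profileWindowField ν v s (A ζ)) univ :=
      hPW.comp (Acl.analyticOnNhd univ) fun _ _ => mem_univ _
    have a2 : AnalyticOnNhd ℝ (fun ζ : EuclideanSpace ℝ (Fin 3) => rotZ θ (A.symm (profileWindowField ν v s (A ζ)))) univ := by
      have h := Rcl.comp_analyticOnNhd (Ascl.comp_analyticOnNhd a1)
      exact h
    have a3 : AnalyticOnNhd ℝ (fun ζ : EuclideanSpace ℝ (Fin 3) => A (rotZ θ ζ)) univ := by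
      have h := Acl.comp_analyticOnNhd (Rcl.analyticOnNhd univ)
      exact h
    have a4 : AnalyticOnNhd ℝ (fun ζ : EuclideanSpace ℝ (Fin 3) => A.symm (profileWindowField ν v s (A (rotZ θ ζ)))) univ := by
      have h := Ascl.comp_analyticOnNhd (hPW.comp a3 fun _ _ => mem_univ _)
      exact h
    exact a2.sub a4
  -- `f = 0` on the window, hence everywhere
  have hfU : ∀ ζ ∈ U, f ζ = 0 := fun ζ hζ => norm_eq_zero.1 (hwin θ ζ hζ)
  obtain ⟨ζ₀, hζ₀⟩ := hUne
  have hev : f =ᶠ[𝓝 ζ₀] 0 := by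
    filter_upwards [hU.mem_nhds hζ₀] with ζ hζ
    exact hfU ζ hζ
  have hzero : EqOn f 0 univ :=
    hfan.eqOn_zero_of_preconnected_of_eventuallyEq_zero isPreconnected_univ (mem_univ ζ₀) hev
  -- read the identity at `ζ = σ⁻¹ • x`
  have h := hzero (mem_univ (σ⁻¹ • x))
  simp only [hf, Pi.zero_apply, profileWindowField, sub_eq_zero, LinearIsometryEquiv.map_smul, SereginSverak2009.rotZ_smul_vec,
    smul_smul] at h
  rw [← hσ, mul_inv_cancel₀ hσpos.ne', one_smul, one_smul] at h
  show A.symm (v s (A (rotZ θ x))) = rotZ θ (A.symm (v s (A x)))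
  exact (smul_right_injective (EuclideanSpace ℝ (Fin 3)) hσν h).symm

end Limit

/-! ## §6 K-axi PROVED: ε-stability of the axisymmetric Type-I Liouville theorem -/

/-- **K-axi `AxiStability` HOLDS.**  Bad sequence `εₙ = 1/(n+1)` ⇒ B0 normalisation (witness `η ≤ ‖vₙ(−1, zₙ)‖`, `‖zₙ‖ ≤ R`)
⇒ E1 extraction ⇒ E2 classical limit ⇒ E3 analytic slices ⇒ §5 (zero defect, exact axisymmetry of every slice below `−1/4`)
⇒ the shifted limit `V(τ) = v(τ − 1/4)` is an ancient mild Type-I(`D`) solution axisymmetric about `A e₃` ⇒ KNSS ⇒ `V ≡ 0`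
⇒ `v(−1, x̄) = 0`, contradicting `η ≤ ‖v(−1, x̄)‖`. -/
theorem axiStability_holds : AxiStability := by
  intro ν D A hν hD U hU hUne hUbdd
  by_contra hbad
  have hbad' : ∀ ε : ℝ, 0 < ε → ∃ (u : ℝ → EuclideanSpace ℝ (Fin 3) → EuclideanSpace ℝ (Fin 3))
      (p : ℝ → EuclideanSpace ℝ (Fin 3) → ℝ), IsClassicalNSSolutionOn (Iio 0) 1 0 u p ∧ HasTypeIDecay D u ∧
      HasSmallAxiDefectOn ν A ε U u ∧ ∃ t < 0, ∃ x, u t x ≠ 0 := by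
    by_contra hno
    push Not at hno
    obtain ⟨ε, hε, hall⟩ := hno
    exact hbad ⟨ε, hε, fun u p hcl hdec hsm t ht x => hall u p hcl hdec hsm t ht x⟩
  have hT0 : (-1 : ℝ) < 0 := by norm_num
  obtain ⟨η, hη, R, hnorm⟩ := normalise hD hT0
  -- the normalised bad sequence
  have hseq : ∀ n : ℕ, ∃ (w : ℝ → EuclideanSpace ℝ (Fin 3) → EuclideanSpace ℝ (Fin 3)) (q : ℝ → EuclideanSpace ℝ (Fin 3) → ℝ),
      IsClassicalNSSolutionOn (Iio 0) 1 0 w q ∧ HasTypeIDecay D w ∧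
      HasSmallAxiDefectOn ν A (1 / ((n : ℝ) + 1)) U w ∧ ∃ z : EuclideanSpace ℝ (Fin 3), ‖z‖ ≤ R ∧ η ≤ ‖w (-1) z‖ := by
    intro n
    obtain ⟨u, p, hcl, hdec, hsm, hnt⟩ := hbad' (1 / ((n : ℝ) + 1)) (by positivity)
    obtain ⟨lam, hlam, z, hz, hηz⟩ := hnorm u p hcl hdec hnt
    exact ⟨nsRescale lam u, nsRescalePressure lam p, isClassical_nsRescale hcl hlam, hasTypeIDecay_nsRescale hdec hlam,
      hasSmallAxiDefectOn_nsRescale hsm hlam, z, hz, hηz⟩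
  choose vn qn hcl hdec hsm zn hzn hηn using hseq
  -- E1 extraction, E2 classical limit, E3 analytic slices (all tree theorems)
  obtain ⟨φ, v, hφ, hvc, hbw, hlu, hdecv, xbar, hxbar⟩ := extraction (T := -1) hD le_rfl hcl hdec hzn hηn
  obtain ⟨q, hclv⟩ := classical_limit hD hvc hbw hdecv
  obtain ⟨hL, hD'⟩ := bounds_of_decay hD hdecv
  have han := analytic_slices_of_decay hclv hL hD'
  -- pointwise convergence along `φ` below `-1/4`
  have hcc := tendsto_of_locUnif hlu strictMono_id
  have hpt : ∀ t < -(1 / 4 : ℝ), ∀ y, Tendsto (fun n => vn (φ n) t y) atTop (𝓝 (v t y)) := by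
    intro t ht y
    have h := hcc t ht y (fun _ => t) (fun _ => y) tendsto_const_nhds tendsto_const_nhds
    simpa using h
  have hεn : Tendsto (fun n => 1 / (((φ n : ℕ) : ℝ) + 1)) atTop (𝓝 0) :=
    (tendsto_one_div_add_atTop_nhds_zero_nat (𝕜 := ℝ)).comp hφ.tendsto_atTop
  have hslice : ∀ n, ∀ t < 0, Continuous (vn (φ n) t) := fun n t ht =>
    ((hcl (φ n)).contDiff_velocity (by exact ht)).continuous
  have hvslice : ∀ t : ℝ, Continuous (v t) := fun t => hvc.comp (Continuous.prodMk_right t)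
  -- §5: zero defect on the window, exact axisymmetry of every slice below `-1/4`
  have hzero := axiDefect_limit_eq_zero (ν := ν) (t₁ := -(1 / 4 : ℝ)) (by norm_num) hεn hslice (fun t _ => hvslice t) hpt A hU
    (fun n => hsm (φ n))
  have haxi : ∀ s < -(1 / 4 : ℝ), IsAxisymmetric (fun x => A.symm (v s (A x))) := fun s hs =>
    isAxisymmetric_conj_of_window hν (by linarith) (han s hs) A hU hUne (fun θ ζ hζ => hzero s hs θ ζ hζ)
  -- the shifted limit `V τ = v (τ - 1/4)` on `(-∞, 0)`
  set V : ℝ → EuclideanSpace ℝ (Fin 3) → EuclideanSpace ℝ (Fin 3) := fun τ => v (τ + -(1 / 4 : ℝ)) with hV_def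
  have hVcl : IsClassicalNSSolutionOn (Iio 0) 1 0 V (fun τ => q (τ + -(1 / 4 : ℝ))) := by
    have h1 := hclv.comp_add_right (-(1 / 4 : ℝ))
    have hS : (fun τ : ℝ => τ + -(1 / 4 : ℝ)) ⁻¹' Iio (-(1 / 4 : ℝ)) = Iio 0 := by
      ext τ
      simp only [mem_preimage, mem_Iio]
      constructor <;> intro h <;> linarith
    rw [hS] at h1
    exact h1
  have hVdec : HasTypeIDecay D V := by
    intro τ hτ y
    have h1 := hdecv (τ + -(1 / 4 : ℝ)) (by linarith) y
    have hsqrt : Real.sqrt (-τ) ≤ Real.sqrt (-(τ + -(1 / 4 : ℝ))) := Real.sqrt_le_sqrt (by linarith)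
    have hpos : 0 < ‖y‖ + Real.sqrt (-τ) := by
      have := Real.sqrt_pos.2 (neg_pos.2 hτ); positivity
    calc ‖V τ y‖ = ‖v (τ + -(1 / 4 : ℝ)) y‖ := rfl
      _ ≤ D / (‖y‖ + Real.sqrt (-(τ + -(1 / 4 : ℝ)))) := h1
      _ ≤ D / (‖y‖ + Real.sqrt (-τ)) := div_le_div_of_nonneg_left hD.le hpos (by linarith)
  have hVmild : IsAncientMildSolution 1 V :=
    (Summit.NavierStokesRegularity.NavierStokesRegularity.Theorems.PolyhedralDssProfileExists.Birth.isTypeIAncientMild_of_classical_typeI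
      hVcl hVdec).isAncientMildSolution
  have hVslice : ∀ τ : ℝ, Continuous (V τ) := fun τ => hvslice (τ + -(1 / 4 : ℝ))
  have hVmeas : ∀ τ < 0, AEStronglyMeasurable (V τ) volume := fun τ _ => (hVslice τ).aestronglyMeasurable
  have haxiV : ∀ τ < 0, IsAxisymmetric (fun x => A.symm (V τ (A x))) := fun τ hτ =>
    haxi (τ + -(1 / 4 : ℝ)) (by linarith)
  -- the axisymmetric Type-I Liouville theorem (KNSS 2009, tree) on the shifted limit
  have hae := hVmild.ae_eq_zero_of_isAxisymmetric_conj_of_hasTypeIDecay hVmeas A haxiV hVdec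
  have hV0 : ∀ τ < 0, V τ = 0 := fun τ hτ =>
    ((hVslice τ).ae_eq_iff_eq volume continuous_const).1 (hae τ hτ)
  -- the witness survives at `τ = -3/4`
  have h0 : v (-1) xbar = 0 := by
    have h := congrFun (hV0 (-(3 / 4 : ℝ)) (by norm_num)) xbar
    simp only [hV_def, Pi.zero_apply] at h
    norm_num at h
    exact h
  have : η ≤ 0 := by simpa [h0] using hxbar
  exact absurd this (not_le.2 hη)

/-! ## §7 The unconditional door -/

/-- **DOOR T-axi «no ε-axisymmetric Type-I blow-up» HOLDS (unconditionally): K1-axi, K-axi are theorems.** -/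
theorem targetEpsAxisym_holds : TargetEpsAxisym := assemblyAxi_holds localPointZoomAxiDefect_holds axiStability_holds

end Summit.NavierStokesRegularity.NavierStokesRegularity.Theorems.StableStrataDoorAxiStability
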